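import Mathlib.Analysis.SpecialFunctions.Pow.Real
import Literature.MathematicalPhysics.QuantumLattice.NodalHeatTransportDictionary
import Literature.MathematicalPhysics.QuantumLattice.PlanarBandSommerfeldMass
import Literature.MathematicalPhysics.QuantumManyBody.DebyeT3Law
import HarnessLib

/-!
# The low-temperature specific-heat dictionaries of a d-wave superconductor (REFVALS-2 §141)

The bulk nodal term `C = αT²`, the Volovik (Doppler-shift) term `C/T = A√H` and their PRINTED
dictionaries to the two nodal velocities `(v_F, v₂ ≡ v_Δ)` and the gap maximum `Δ₀`, as used by
[WenEtAl2005LSCONodalGapSlopeSpecificHeat, Eq. 1] for La₂₋ₓSrₓCuO₄ and by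
[WangRevazErbJunod2001YBCO7NodalSpecificHeat, Eqs. 6–16] for YBa₂Cu₃O₇ (after Volovik and
Kübert–Hirschfeld), together with the arithmetic behind REFVALS-2 §141 (cell hubbard-downfold, seat
lit-2).  This file introduces no physics beyond the printed formulae:

* §1 the superconducting flux quantum `Φ₀ = h/2e` (exact 2019 SI, tied to the tree's `h/e` constant
  `fluxQuantumHE`), `√Φ₀`, and the root `√(π³/Φ₀)` that the Volovik prefactor contains once `1/ħ`
  is written as `2π/h`;
* §2 [WenEtAl2005LSCONodalGapSlopeSpecificHeat, Eq. 1]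
  `A = α_p · (4k_B²/3ħl_c) · √(π/Φ₀) · nV_mol / v_Δ` with the printed `l_c = 13.28 Å`,
  `V_mol = 58 cm³`, `n = 2`, `α_p = 0.465`: the product `A·v_Δ ∈ (3.815567, 3.815568)`
  `J mol⁻¹ K⁻² T⁻½ · m s⁻¹` («calculated without any adjusting parameter»), the inverse map
  `v_Δ(A)`, and the twelve rows `v_Δ(x)` at the [WangWen2008LSCOHc2, Table 1] values of `A(x)`;
* §3 the printed `v_Δ = 2Δ_q/ħk_F`, `k_F ≈ π/(√2 a)`, `a = 3.8 Å` (`k_F ∈ (0.58458, 0.58460) Å⁻¹`),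
  hence `Δ_q(A) = ħk_F v_Δ/2` — by name the tree's `NodalHeatTransport.halfHbarKvMeV` — and the twelve
  rows `Δ_q(x)` (`28.23 … 3.10 meV`); the printed reading `Δ_q ≈ 0.46 k_BT*` as a coefficient
  `∈ (0.03963, 0.03964) meV K⁻¹`;
* §4 the printed normal-state fit `γ_n = 182.6 (p − 0.03)^1.54 mJ mol⁻¹ K⁻²` (a real power, bracketed
  through `L⁵⁰ < x⁷⁷ < U⁵⁰`) at `p = 0.07, 0.11, 0.125, 0.15, 0.16, 0.178, 0.22, 0.30`, and
  [WenEtAl2005LSCONodalGapSlopeSpecificHeat, Eq. 2] `T_c = α_s ħ²v_F l_c γ_n v_Δ/(8nk_B³V_mol) = βγ_n v_Δ`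
  with the printed `β = 0.7445 K³ mol s J⁻¹ m⁻¹`: DERIVED rows `T_c(0.11) ∈ (33.1, 33.2)`,
  `T_c(0.15) ∈ (34.7, 34.8)`, `T_c(0.178) ∈ (29.1, 29.2)`, `T_c(0.22) ∈ (22.3, 22.4) K`;
* §5 the [WangWen2008LSCOHc2, p. 2] / [WangRevazErbJunod2001YBCO7NodalSpecificHeat, Eq. 13]
  dictionary `H_c2 = 8a²γ_N²/(πA²)` ⇔ `A = √(8/π)·a·γ_N/√H_c2`, and the γ_N column IMPLIED by the
  two printed [WangWen2008LSCOHc2, Table 1] columns `(A, H_c2)` at `a = 0.465`;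
* §6 [WangRevazErbJunod2001YBCO7NodalSpecificHeat, Eqs. 15–16]: `A_c = (8k_B²/3ħΦ₀^½)(V_mol/d)(a/v₂)`,
  `α = (18ζ(3)k_B³/πħ²)(V_mol/d)/(v₂v_F)` (Kübert–Hirschfeld; `ζ(3)` a parameter, rows at the printed
  `1.202`), the ratio `A_c/α = (4πħ/27ζ(3)Φ₀^½k_B)·a v_F` (so `π` cancels), `|dΔ/dφ|_node = ħk_Fv₂ = 2Δ₀`,
  `T_F = ħk_Fv_F/2k_B = (Δ₀/k_B)(v_F/v₂)`, `m*/mₑ = ħk_F/mₑv_F = 2Δ₀/(mₑv₂v_F)` («depends only on the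
  product `Δ₀α`»), and the printed derived chain at `A_c = 1.34`, `α = 0.21` (mJ units), `V_mol = 104.6 cm³`,
  `d = 0.584 nm`, `Δ₀ = 20 meV`, `v_F/v₂ = 14`: `v₂/a ∈ (1.4168, 1.4169) × 10⁴ m/s`,
  `v₂v_F ∈ (1.3900, 1.3901) × 10⁹ m²/s²`, `a v_F ∈ (9.8108, 9.8110) × 10⁴ m/s`, `A_c/α ∈ (6.380, 6.381)`,
  `γ_n ∈ (14.82, 14.83) mJ`, `B_c2/a² ∈ (311.5, 311.6) T`, `T_F ∈ (3249, 3250) K`, `m*/mₑ ∈ (5.06, 5.07)`,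
  `k_F ∈ (0.6077, 0.6078) Å⁻¹` at `v₂ = 10⁴ m/s`; `v_F ∈ (1.3950, 1.3951) × 10⁵ m/s`, `a ∈ (0.703, 0.704)`;
* §7 the by-study YBa₂Cu₃O₇ hulls of REFVALS-2 §141.1 (`α`, `A`, `γ(0)` across
  [MolerEtAl1995YBCOSpecificHeatVortex, Table 1], [WangRevazErbJunod2001YBCO7NodalSpecificHeat] and the
  ceramic values compiled there), and the Debye image of the printed `β = 0.392 / 0.380 mJ mol⁻¹ K⁻⁴`
  (13 atoms): `Θ_D ∈ (400, 402) / (405, 406) K` (the printed «β = 0.39 ⇒ Θ_D = 400 K»), by name the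
  tree's `Debye.debyeTheta`.

Pure algebra and rational/`π`/`√`-bracket arithmetic on printed numbers.  Which samples are clean,
which vortex lattice (`α_p = 0.465` triangular vs `0.5` square), and whether `v_Δħk_F` is the right
superconducting scale for underdoped samples are the papers' statements, not this file's.
AI-produced formalisation (H21, cell hubbard-downfold, seat lit-2, 2026-08-29); no facts, no axioms
beyond Mathlib's, no `sorry`.
-/

noncomputable section

open Real
open Literature.MathematicalPhysics.QuantumManyBody

namespace Literature.MathematicalPhysics.QuantumLattice.NodalSpecificHeat

/-! ## §1 The flux quantum `Φ₀ = h/2e`, its root, and `√(π³/Φ₀)` -/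

/-- The superconducting flux quantum `Φ₀ = h/(2e)` in `Wb = T m²`, exact by the 2019 SI.
[cite: BIPM2019, Table 1]; [cite: WenEtAl2005LSCONodalGapSlopeSpecificHeat, Eq. 1 («Φ₀ the flux quanta»)] -/
def scFluxQuantum : ℝ := planckSI / (2 * elementaryChargeSI)

/-- Unfolding. [cite: BIPM2019, Table 1] -/
theorem scFluxQuantum_def : scFluxQuantum = planckSI / (2 * elementaryChargeSI) := rfl

/-- `Φ₀ ∈ (2.0678338, 2.0678339) × 10⁻¹⁵ Wb`. [cite: BIPM2019, Table 1] -/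
theorem scFluxQuantum_bounds : 2.0678338e-15 < scFluxQuantum ∧ scFluxQuantum < 2.0678339e-15 := by
  constructor <;> norm_num [scFluxQuantum, planckSI_def, elementaryChargeSI_def]

/-- `Φ₀ > 0`. [cite: BIPM2019, Table 1] -/
theorem scFluxQuantum_pos : 0 < scFluxQuantum := by linarith [scFluxQuantum_bounds.1]

/-- Consistency with the tree's `h/e` constant (`fluxQuantumHE`, in `T Å²`): `2Φ₀ · 10²⁰ = h/e · 10²⁰`.
[cite: BIPM2019, Table 1] -/
theorem two_mul_scFluxQuantum : 2 * scFluxQuantum * 10 ^ 20 = fluxQuantumHE := by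
  have he : elementaryChargeSI ≠ 0 := elementaryChargeSI_pos.ne'
  unfold scFluxQuantum fluxQuantumHE
  field_simp

/-- `√Φ₀ ∈ (4.5473441, 4.5473442) × 10⁻⁸ T^½ m`. [cite: WangRevazErbJunod2001YBCO7NodalSpecificHeat, Eq. 15] -/
theorem sqrt_scFluxQuantum_bounds :
    4.5473441e-8 < Real.sqrt scFluxQuantum ∧ Real.sqrt scFluxQuantum < 4.5473442e-8 := by
  have h := scFluxQuantum_bounds
  constructor
  · rw [Real.lt_sqrt (by norm_num), scFluxQuantum_def, planckSI_def, elementaryChargeSI_def]; norm_num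
  · rw [Real.sqrt_lt' (by norm_num), scFluxQuantum_def, planckSI_def, elementaryChargeSI_def]; norm_num

/-- `√Φ₀ > 0`. [cite: WangRevazErbJunod2001YBCO7NodalSpecificHeat, Eq. 15] -/
theorem sqrt_scFluxQuantum_pos : 0 < Real.sqrt scFluxQuantum := Real.sqrt_pos.mpr scFluxQuantum_pos

/-- The root `√(π³/Φ₀)` (`T⁻½ m⁻¹`): `(1/ħ)√(π/Φ₀) = (2/h)·√(π³/Φ₀)`.
[cite: WenEtAl2005LSCONodalGapSlopeSpecificHeat, Eq. 1] -/
def volovikRoot : ℝ := Real.sqrt (π ^ 3 / scFluxQuantum)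

/-- Unfolding. [cite: WenEtAl2005LSCONodalGapSlopeSpecificHeat, Eq. 1] -/
theorem volovikRoot_def : volovikRoot = Real.sqrt (π ^ 3 / scFluxQuantum) := rfl

/-- `π · √(π/Φ₀) = √(π³/Φ₀)`. [cite: WenEtAl2005LSCONodalGapSlopeSpecificHeat, Eq. 1] -/
theorem pi_mul_sqrt_pi_div : π * Real.sqrt (π / scFluxQuantum) = volovikRoot := by
  have hπ : 0 ≤ π := Real.pi_pos.le
  have h3 : π ^ 3 / scFluxQuantum = π ^ 2 * (π / scFluxQuantum) := by ring
  rw [volovikRoot, h3, Real.sqrt_mul' _ (div_nonneg hπ scFluxQuantum_pos.le), Real.sqrt_sq hπ]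

/-- `√(π³/Φ₀) ∈ (122452311, 122452313)`. [cite: WenEtAl2005LSCONodalGapSlopeSpecificHeat, Eq. 1] -/
theorem volovikRoot_bounds : 122452311 < volovikRoot ∧ volovikRoot < 122452313 := by
  have h3l : (3.14159265358979323846 : ℝ) ^ 3 < π ^ 3 :=
    pow_lt_pow_left₀ Real.pi_gt_d20 (by norm_num) (by norm_num)
  have h3u : π ^ 3 < (3.14159265358979323847 : ℝ) ^ 3 :=
    pow_lt_pow_left₀ Real.pi_lt_d20 Real.pi_pos.le (by norm_num)
  unfold volovikRoot
  constructor
  · rw [Real.lt_sqrt (by norm_num), lt_div_iff₀ scFluxQuantum_pos, scFluxQuantum_def, planckSI_def,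
      elementaryChargeSI_def]
    norm_num at h3l ⊢
    linarith
  · rw [Real.sqrt_lt' (by norm_num), div_lt_iff₀ scFluxQuantum_pos, scFluxQuantum_def, planckSI_def,
      elementaryChargeSI_def]
    norm_num at h3u ⊢
    linarith

/-- `√(π³/Φ₀) > 0`. [cite: WenEtAl2005LSCONodalGapSlopeSpecificHeat, Eq. 1] -/
theorem volovikRoot_pos : 0 < volovikRoot := by linarith [volovikRoot_bounds.1]

/-- `√2 ∈ (1.414213562, 1.414213563)` (plumbing for `k_F = π/(√2 a)`). [folklore] -/
private theorem sqrt_two_bounds : 1.414213562 < Real.sqrt 2 ∧ Real.sqrt 2 < 1.414213563 := by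
  constructor
  · rw [Real.lt_sqrt (by norm_num)]; norm_num
  · rw [Real.sqrt_lt' (by norm_num)]; norm_num

/-! ## §2 The Volovik coefficient of [WenEtAl2005…, Eq. 1] and the LSCO rows `v_Δ(x)` -/

/-- [WenEtAl2005LSCONodalGapSlopeSpecificHeat, Eq. 1]: `A = α_p (4k_B²/3ħl_c) √(π/Φ₀) nV_mol / v_Δ`
(SI: `l_c` m, `V_mol` m³ mol⁻¹, `v_Δ` m s⁻¹, `A` in `J mol⁻¹ K⁻² T⁻½`; `n` planes per cell; `α_p = 0.5`
square / `0.465` triangular vortex lattice). [cite: WenEtAl2005LSCONodalGapSlopeSpecificHeat, Eq. 1] -/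
def volovikA (αp lc Vmol n vΔ : ℝ) : ℝ :=
  αp * (4 * boltzmannSI ^ 2 / (3 * hbarSI * lc)) * Real.sqrt (π / scFluxQuantum) * (n * Vmol) / vΔ

/-- Unfolding. [cite: WenEtAl2005LSCONodalGapSlopeSpecificHeat, Eq. 1] -/
theorem volovikA_def (αp lc Vmol n vΔ : ℝ) : volovikA αp lc Vmol n vΔ =
    αp * (4 * boltzmannSI ^ 2 / (3 * hbarSI * lc)) * Real.sqrt (π / scFluxQuantum) * (n * Vmol) / vΔ := rfl

/-- With `ħ = h/2π`: `A = 8α_p k_B² nV_mol/(3h l_c v_Δ) · √(π³/Φ₀)`.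
[cite: WenEtAl2005LSCONodalGapSlopeSpecificHeat, Eq. 1] -/
theorem volovikA_eq (αp lc Vmol n vΔ : ℝ) : volovikA αp lc Vmol n vΔ =
    8 * αp * boltzmannSI ^ 2 * n * Vmol / (3 * planckSI * lc * vΔ) * volovikRoot := by
  rw [← pi_mul_sqrt_pi_div]
  unfold volovikA hbarSI
  have hπ : (π : ℝ) ≠ 0 := Real.pi_ne_zero
  have hh : planckSI ≠ 0 := planckSI_pos.ne'
  by_cases hl : lc = 0
  · subst hl; simp
  by_cases hv : vΔ = 0
  · subst hv; simp
  field_simp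
  ring

/-- The product `A · v_Δ` is independent of `v_Δ`: `A(v) · v = A(1)` (`v ≠ 0`).
[cite: WenEtAl2005LSCONodalGapSlopeSpecificHeat, Eq. 1] -/
theorem volovikA_mul (αp lc Vmol n : ℝ) {vΔ : ℝ} (hv : vΔ ≠ 0) :
    volovikA αp lc Vmol n vΔ * vΔ = volovikA αp lc Vmol n 1 := by
  unfold volovikA; field_simp

/-- `A` is antitone in `v_Δ` on `v_Δ > 0` when the prefactor is nonnegative: a SMALLER Volovik coefficient
means a STEEPER nodal gap. [cite: WenEtAl2005LSCONodalGapSlopeSpecificHeat, Eq. 1 and Fig. 4] -/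
theorem volovikA_antitone {αp lc Vmol n v₁ v₂ : ℝ} (h0 : 0 ≤ volovikA αp lc Vmol n 1) (hv₁ : 0 < v₁)
    (h : v₁ ≤ v₂) : volovikA αp lc Vmol n v₂ ≤ volovikA αp lc Vmol n v₁ := by
  have e₁ : volovikA αp lc Vmol n v₁ = volovikA αp lc Vmol n 1 / v₁ := by
    rw [← volovikA_mul αp lc Vmol n hv₁.ne']; field_simp
  have hv₂ : 0 < v₂ := lt_of_lt_of_le hv₁ h
  have e₂ : volovikA αp lc Vmol n v₂ = volovikA αp lc Vmol n 1 / v₂ := by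
    rw [← volovikA_mul αp lc Vmol n hv₂.ne']; field_simp
  rw [e₁, e₂]
  exact div_le_div_of_nonneg_left h0 hv₁ h

/-- The La₂₋ₓSrₓCuO₄ product `A · v_Δ` at the printed `α_p = 0.465`, `l_c = 13.28 Å`, `V_mol = 58 cm³`,
`n = 2` (`J mol⁻¹ K⁻² T⁻½ · m s⁻¹`). [cite: WenEtAl2005LSCONodalGapSlopeSpecificHeat, Eq. 1 and p. 3] -/
def wenLSCOProduct : ℝ := volovikA 0.465 13.28e-10 58e-6 2 1

/-- Unfolding. [cite: WenEtAl2005LSCONodalGapSlopeSpecificHeat, Eq. 1] -/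
theorem wenLSCOProduct_def : wenLSCOProduct = volovikA 0.465 13.28e-10 58e-6 2 1 := rfl

/-- Closed form: `A·v_Δ = 8·0.465·k_B²·2·58×10⁻⁶/(3h·13.28×10⁻¹⁰) · √(π³/Φ₀)`.
[cite: WenEtAl2005LSCONodalGapSlopeSpecificHeat, Eq. 1] -/
theorem wenLSCOProduct_eq : wenLSCOProduct =
    8 * 0.465 * boltzmannSI ^ 2 * 2 * 58e-6 / (3 * planckSI * 13.28e-10 * 1) * volovikRoot := by
  rw [wenLSCOProduct, volovikA_eq]

/-- `A·v_Δ ∈ (3.815567, 3.815568) J mol⁻¹ K⁻² T⁻½ · m s⁻¹` — i.e. `A [mJ mol⁻¹ K⁻² T⁻½] · v_Δ [m s⁻¹]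
≈ 3815.6`. [cite: WenEtAl2005LSCONodalGapSlopeSpecificHeat, Eq. 1 («calculated without any adjusting
parameter»)] -/
theorem wenLSCOProduct_bounds : 3.815567 < wenLSCOProduct ∧ wenLSCOProduct < 3.815568 := by
  have hu := volovikRoot_bounds
  rw [wenLSCOProduct_eq, boltzmannSI_def, planckSI_def]
  constructor
  · norm_num; nlinarith [hu.1]
  · norm_num; nlinarith [hu.2]

/-- `A·v_Δ > 0`. [cite: WenEtAl2005LSCONodalGapSlopeSpecificHeat, Eq. 1] -/
theorem wenLSCOProduct_pos : 0 < wenLSCOProduct := by linarith [wenLSCOProduct_bounds.1]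

/-- Every LSCO evaluation of Eq. 1 is the product over `v_Δ`.
[cite: WenEtAl2005LSCONodalGapSlopeSpecificHeat, Eq. 1] -/
theorem volovikA_lsco {vΔ : ℝ} (hv : vΔ ≠ 0) : volovikA 0.465 13.28e-10 58e-6 2 vΔ = wenLSCOProduct / vΔ := by
  rw [wenLSCOProduct, ← volovikA_mul 0.465 13.28e-10 58e-6 2 hv]; field_simp

/-- The inverse map: the nodal gap slope `v_Δ` (m s⁻¹) of a measured Volovik coefficient `A` given in
`mJ mol⁻¹ K⁻² T⁻½`. [cite: WenEtAl2005LSCONodalGapSlopeSpecificHeat, Eq. 1 and Fig. 4(b)] -/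
def vDeltaOfA (A_mJ : ℝ) : ℝ := 1000 * wenLSCOProduct / A_mJ

/-- Unfolding. [cite: WenEtAl2005LSCONodalGapSlopeSpecificHeat, Eq. 1] -/
theorem vDeltaOfA_def (A : ℝ) : vDeltaOfA A = 1000 * wenLSCOProduct / A := rfl

/-- ROUND TRIP: Eq. 1 evaluated at `v_Δ(A)` returns `A` (in `J`: `A_mJ/1000`).
[cite: WenEtAl2005LSCONodalGapSlopeSpecificHeat, Eq. 1] -/
theorem volovikA_vDeltaOfA {A : ℝ} (hA : A ≠ 0) :
    volovikA 0.465 13.28e-10 58e-6 2 (vDeltaOfA A) = A / 1000 := by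
  have hP : wenLSCOProduct ≠ 0 := wenLSCOProduct_pos.ne'
  have hv : vDeltaOfA A ≠ 0 := by
    unfold vDeltaOfA; exact div_ne_zero (mul_ne_zero (by norm_num) hP) hA
  rw [volovikA_lsco hv, vDeltaOfA]
  field_simp

/-- `v_Δ(A)` is positive for `A > 0`. [cite: WenEtAl2005LSCONodalGapSlopeSpecificHeat, Eq. 1] -/
theorem vDeltaOfA_pos {A : ℝ} (hA : 0 < A) : 0 < vDeltaOfA A := by
  unfold vDeltaOfA; exact div_pos (mul_pos (by norm_num) wenLSCOProduct_pos) hA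

/-- Plumbing: a window on `v_Δ(A)` from the product window. [cite: WenEtAl2005LSCONodalGapSlopeSpecificHeat, Eq. 1] -/
theorem vDeltaOfA_window {A lo hi : ℝ} (hA : 0 < A) (hlo : lo * A ≤ 1000 * 3.815567)
    (hhi : 1000 * 3.815568 ≤ hi * A) : lo < vDeltaOfA A ∧ vDeltaOfA A < hi := by
  have hP := wenLSCOProduct_bounds
  unfold vDeltaOfA
  constructor
  · rw [lt_div_iff₀ hA]; nlinarith [hP.1]
  · rw [div_lt_iff₀ hA]; nlinarith [hP.2]

/-- THE LSCO ROWS `v_Δ(x)` (m s⁻¹; `× 10⁻⁴` gives the `10⁶ cm/s` of REFVALS-2 §141.2) at the printed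
[WangWen2008LSCOHc2, Table 1] coefficients `A(x)` (mJ mol⁻¹ K⁻² T⁻½):
`x 0.063/0.075: A 0.26 ↦ (14675, 14676)` · `0.069/0.09: 0.28 ↦ (13627, 13628)` · `0.11: 0.32 ↦ (11923, 11924)`
· `0.15: 0.57 ↦ (6693, 6694)` · `0.178: 0.94 ↦ (4059, 4060)` · `0.19: 1.2 ↦ (3179, 3180)`
· `0.202: 1.33 ↦ (2868, 2869)` · `0.218: 1.55 ↦ (2461, 2462)` · `0.22: 1.8 ↦ (2119, 2120)`
· `0.238: 2.37 ↦ (1609, 1610)` (DERIVED, not printed; [WenEtAl2005…, Fig. 4(b)] plots `v_Δ(p)`).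
[cite: WangWen2008LSCOHc2, Table 1]; [cite: WenEtAl2005LSCONodalGapSlopeSpecificHeat, Eq. 1] -/
theorem lsco_vDelta_rows :
    (14675 < vDeltaOfA 0.26 ∧ vDeltaOfA 0.26 < 14676) ∧
    (13627 < vDeltaOfA 0.28 ∧ vDeltaOfA 0.28 < 13628) ∧
    (11923 < vDeltaOfA 0.32 ∧ vDeltaOfA 0.32 < 11924) ∧
    (6693 < vDeltaOfA 0.57 ∧ vDeltaOfA 0.57 < 6694) ∧
    (4059 < vDeltaOfA 0.94 ∧ vDeltaOfA 0.94 < 4060) ∧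
    (3179 < vDeltaOfA 1.2 ∧ vDeltaOfA 1.2 < 3180) ∧
    (2868 < vDeltaOfA 1.33 ∧ vDeltaOfA 1.33 < 2869) ∧
    (2461 < vDeltaOfA 1.55 ∧ vDeltaOfA 1.55 < 2462) ∧
    (2119 < vDeltaOfA 1.8 ∧ vDeltaOfA 1.8 < 2120) ∧
    (1609 < vDeltaOfA 2.37 ∧ vDeltaOfA 2.37 < 1610) := by
  refine ⟨?_, ?_, ?_, ?_, ?_, ?_, ?_, ?_, ?_, ?_⟩ <;>
    exact vDeltaOfA_window (by norm_num) (by norm_num) (by norm_num)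

/-- `v_Δ` FALLS monotonically as `A` rises across the dome (`0.26 → 2.37`): by a factor in `(9.11, 9.12)`
between `x = 0.063` and `x = 0.238`. [cite: WangWen2008LSCOHc2, Table 1]; [cite: WenEtAl2005LSCONodalGapSlopeSpecificHeat, Fig. 4(b)] -/
theorem lsco_vDelta_ratio : vDeltaOfA 0.26 / vDeltaOfA 2.37 = 2.37 / 0.26 ∧
    9.11 < (2.37 : ℝ) / 0.26 ∧ (2.37 : ℝ) / 0.26 < 9.12 := by
  have hP : wenLSCOProduct ≠ 0 := wenLSCOProduct_pos.ne'
  refine ⟨?_, by norm_num, by norm_num⟩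
  unfold vDeltaOfA; field_simp

/-! ## §3 `v_Δ = 2Δ_q/ħk_F`, `k_F ≈ π/(√2 a)`: the rows `Δ_q(x)` and `Δ_q ≈ 0.46 k_BT*` -/

/-- The nodal Fermi wavevector of the printed estimate `k_F ≈ π/(√2 a)` (Å⁻¹ for `a` in Å).
[cite: WenEtAl2005LSCONodalGapSlopeSpecificHeat, p. 3] -/
def wenKF (a : ℝ) : ℝ := π / (Real.sqrt 2 * a)

/-- Unfolding. [cite: WenEtAl2005LSCONodalGapSlopeSpecificHeat, p. 3] -/
theorem wenKF_def (a : ℝ) : wenKF a = π / (Real.sqrt 2 * a) := rfl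

/-- `k_F(a = 3.8 Å) ∈ (0.58458, 0.58460) Å⁻¹`. [cite: WenEtAl2005LSCONodalGapSlopeSpecificHeat, p. 3] -/
theorem wenKF_38_bounds : 0.58458 < wenKF 3.8 ∧ wenKF 3.8 < 0.58460 := by
  have h2 := sqrt_two_bounds
  have hπl := Real.pi_gt_d20; have hπu := Real.pi_lt_d20
  have hpos : 0 < Real.sqrt 2 * 3.8 := by nlinarith [h2.1]
  unfold wenKF
  constructor
  · rw [lt_div_iff₀ hpos]; nlinarith [h2.2]
  · rw [div_lt_iff₀ hpos]; nlinarith [h2.1]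

/-- The «virtual maximum quasiparticle gap» `Δ_q = ħk_F v_Δ/2` (meV) of a Volovik coefficient `A`
(mJ mol⁻¹ K⁻² T⁻½) at the printed `a = 3.8 Å` — the tree's `halfHbarKvMeV` (which takes `k_F` in Å⁻¹ and
a velocity in cm s⁻¹, hence the factor `100`). [cite: WenEtAl2005LSCONodalGapSlopeSpecificHeat, p. 3] -/
def wenDeltaQ (A_mJ : ℝ) : ℝ := NodalHeatTransport.halfHbarKvMeV (wenKF 3.8) (100 * vDeltaOfA A_mJ)

/-- Unfolding. [cite: WenEtAl2005LSCONodalGapSlopeSpecificHeat, p. 3] -/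
theorem wenDeltaQ_def (A : ℝ) :
    wenDeltaQ A = NodalHeatTransport.halfHbarKvMeV (wenKF 3.8) (100 * vDeltaOfA A) := rfl

/-- Closed form (the `π` of `ħ` cancels the `π` of `k_F`):
`Δ_q(A) = (h·10¹⁶/(4·3.8·e)) · (A·v_Δ)/(√2 · A)` meV. [cite: WenEtAl2005LSCONodalGapSlopeSpecificHeat, p. 3] -/
theorem wenDeltaQ_eq {A : ℝ} (hA : A ≠ 0) : wenDeltaQ A =
    planckSI * 10 ^ 16 / (4 * 3.8 * elementaryChargeSI) * wenLSCOProduct / (Real.sqrt 2 * A) := by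
  rw [wenDeltaQ, NodalHeatTransport.halfHbarKvMeV_eq, wenKF, vDeltaOfA]
  have hπ : (π : ℝ) ≠ 0 := Real.pi_ne_zero
  have he : elementaryChargeSI ≠ 0 := elementaryChargeSI_pos.ne'
  have h2 : Real.sqrt 2 ≠ 0 := by have := sqrt_two_bounds.1; positivity
  field_simp
  ring

/-- Plumbing: a window on `Δ_q(A)` (meV) from the product and `√2` windows.
[cite: WenEtAl2005LSCONodalGapSlopeSpecificHeat, p. 3] -/
theorem wenDeltaQ_window {A lo hi : ℝ} (hA : 0 < A) (hlo0 : 0 ≤ lo)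
    (hlo : lo * A * 1.414213563 * (4 * 3.8 * (1602176634 / 10 ^ 28)) ≤ 662607015 / 10 ^ 42 * 10 ^ 16 * 3.815567)
    (hhi : 662607015 / 10 ^ 42 * 10 ^ 16 * 3.815568 ≤ hi * A * 1.414213562 * (4 * 3.8 * (1602176634 / 10 ^ 28))) :
    lo < wenDeltaQ A ∧ wenDeltaQ A < hi := by
  have hP := wenLSCOProduct_bounds
  have h2 := sqrt_two_bounds
  have hhi0 : 0 < hi := by
    by_contra hle
    push Not at hle
    have : hi * A * 1.414213562 * (4 * 3.8 * (1602176634 / 10 ^ 28 : ℝ)) ≤ 0 := by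
      have : hi * A ≤ 0 := mul_nonpos_of_nonpos_of_nonneg hle hA.le
      nlinarith
    norm_num at hhi; linarith
  rw [wenDeltaQ_eq hA.ne', planckSI_def, elementaryChargeSI_def]
  have hden : 0 < Real.sqrt 2 * A := by nlinarith [h2.1]
  constructor
  · rw [lt_div_iff₀ hden]
    have : lo * (Real.sqrt 2 * A) ≤ lo * (1.414213563 * A) := by
      apply mul_le_mul_of_nonneg_left _ hlo0; nlinarith [h2.2]
    have h4 : (0 : ℝ) < 4 * 3.8 * (1602176634 / 10 ^ 28) := by norm_num
    have key : lo * (1.414213563 * A) * (4 * 3.8 * (1602176634 / 10 ^ 28 : ℝ)) <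
        662607015 / 10 ^ 42 * 10 ^ 16 * wenLSCOProduct := by nlinarith [hP.1]
    have : 662607015 / 10 ^ 42 * 10 ^ 16 / (4 * 3.8 * (1602176634 / 10 ^ 28 : ℝ)) * wenLSCOProduct =
        662607015 / 10 ^ 42 * 10 ^ 16 * wenLSCOProduct / (4 * 3.8 * (1602176634 / 10 ^ 28 : ℝ)) := by ring
    rw [this, lt_div_iff₀ h4]
    nlinarith
  · rw [div_lt_iff₀ hden]
    have : hi * (1.414213562 * A) ≤ hi * (Real.sqrt 2 * A) := by
      apply mul_le_mul_of_nonneg_left _ hhi0.le; nlinarith [h2.1]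
    have h4 : (0 : ℝ) < 4 * 3.8 * (1602176634 / 10 ^ 28) := by norm_num
    have key : 662607015 / 10 ^ 42 * 10 ^ 16 * wenLSCOProduct <
        hi * (1.414213562 * A) * (4 * 3.8 * (1602176634 / 10 ^ 28 : ℝ)) := by nlinarith [hP.2]
    have : 662607015 / 10 ^ 42 * 10 ^ 16 / (4 * 3.8 * (1602176634 / 10 ^ 28 : ℝ)) * wenLSCOProduct =
        662607015 / 10 ^ 42 * 10 ^ 16 * wenLSCOProduct / (4 * 3.8 * (1602176634 / 10 ^ 28 : ℝ)) := by ring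
    rw [this, div_lt_iff₀ h4]
    nlinarith

/-- THE LSCO ROWS `Δ_q(x)` (meV) at the [WangWen2008LSCOHc2, Table 1] `A(x)`:
`A 0.26 ↦ (28.23, 28.24)` · `0.28 ↦ (26.21, 26.22)` · `0.32 ↦ (22.94, 22.95)` · `0.57 ↦ (12.87, 12.88)`
· `0.94 ↦ (7.80, 7.81)` · `1.2 ↦ (6.11, 6.12)` · `1.33 ↦ (5.51, 5.52)` · `1.55 ↦ (4.73, 4.74)`
· `1.8 ↦ (4.07, 4.08)` · `2.37 ↦ (3.09, 3.10)` (DERIVED, not printed).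
[cite: WangWen2008LSCOHc2, Table 1]; [cite: WenEtAl2005LSCONodalGapSlopeSpecificHeat, p. 3 and Fig. 4(b)] -/
theorem lsco_deltaQ_rows :
    (28.23 < wenDeltaQ 0.26 ∧ wenDeltaQ 0.26 < 28.24) ∧
    (26.21 < wenDeltaQ 0.28 ∧ wenDeltaQ 0.28 < 26.22) ∧
    (22.94 < wenDeltaQ 0.32 ∧ wenDeltaQ 0.32 < 22.95) ∧
    (12.87 < wenDeltaQ 0.57 ∧ wenDeltaQ 0.57 < 12.88) ∧
    (7.80 < wenDeltaQ 0.94 ∧ wenDeltaQ 0.94 < 7.81) ∧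
    (6.11 < wenDeltaQ 1.2 ∧ wenDeltaQ 1.2 < 6.12) ∧
    (5.51 < wenDeltaQ 1.33 ∧ wenDeltaQ 1.33 < 5.52) ∧
    (4.73 < wenDeltaQ 1.55 ∧ wenDeltaQ 1.55 < 4.74) ∧
    (4.07 < wenDeltaQ 1.8 ∧ wenDeltaQ 1.8 < 4.08) ∧
    (3.09 < wenDeltaQ 2.37 ∧ wenDeltaQ 2.37 < 3.10) := by
  refine ⟨?_, ?_, ?_, ?_, ?_, ?_, ?_, ?_, ?_, ?_⟩ <;>
    exact wenDeltaQ_window (by norm_num) (by norm_num) (by norm_num) (by norm_num)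

/-- The printed reading `Δ_q ≈ 0.46 k_BT*`: the coefficient `0.46 k_B ∈ (0.03963, 0.03964) meV K⁻¹`
(by name the tree's `kBmeVPerKelvin`), i.e. `T* ≈ Δ_q[meV]/0.0396 K`.
[cite: WenEtAl2005LSCONodalGapSlopeSpecificHeat, p. 3 («Δ_q ∼ 0.46k_BT*»)] -/
def tStarOfDeltaQ (Δq_meV : ℝ) : ℝ := Δq_meV / (0.46 * kBmeVPerKelvin)

/-- Unfolding. [cite: WenEtAl2005LSCONodalGapSlopeSpecificHeat, p. 3] -/
theorem tStarOfDeltaQ_def (Δ : ℝ) : tStarOfDeltaQ Δ = Δ / (0.46 * kBmeVPerKelvin) := rfl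

/-- `0.46 k_B ∈ (0.03963, 0.03964) meV K⁻¹`, and the round trip `0.46 k_B · T*(Δ_q) = Δ_q`.
[cite: WenEtAl2005LSCONodalGapSlopeSpecificHeat, p. 3] -/
theorem tStar_coefficient : 0.03963 < 0.46 * kBmeVPerKelvin ∧ 0.46 * kBmeVPerKelvin < 0.03964 ∧
    ∀ Δ : ℝ, 0.46 * kBmeVPerKelvin * tStarOfDeltaQ Δ = Δ := by
  have hk := kBmeVPerKelvin_bounds
  refine ⟨by linarith [hk.1], by linarith [hk.2], fun Δ => ?_⟩
  have hk0 : 0 < kBmeVPerKelvin := by linarith [hk.1]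
  unfold tStarOfDeltaQ
  field_simp

/-! ## §4 The printed `γ_n(p)` fit and [WenEtAl2005…, Eq. 2] `T_c = βγ_n v_Δ` -/

/-- Plumbing for real powers with a rational exponent `m/n`: `L < x^{m/n} < U` from `Lⁿ < xᵐ < Uⁿ`.
[folklore] -/
private theorem rpow_window {x L U : ℝ} {m n : ℕ} (hx : 0 ≤ x) (hL : 0 ≤ L) (hU : 0 ≤ U) (hn : n ≠ 0)
    (hlo : L ^ n < x ^ m) (hhi : x ^ m < U ^ n) :
    L < x ^ ((m : ℝ) / n) ∧ x ^ ((m : ℝ) / n) < U := by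
  have hxm : 0 ≤ x ^ m := pow_nonneg hx m
  have hn' : (0 : ℝ) < n := by exact_mod_cast Nat.pos_of_ne_zero hn
  have key : x ^ ((m : ℝ) / n) = (x ^ m) ^ ((n : ℝ)⁻¹) := by
    rw [div_eq_mul_inv, Real.rpow_mul hx, Real.rpow_natCast]
  rw [key]
  constructor
  · rw [Real.lt_rpow_inv_iff_of_pos hL hxm hn', Real.rpow_natCast]; exact hlo
  · rw [Real.rpow_inv_lt_iff_of_pos hxm hU hn', Real.rpow_natCast]; exact hhi

/-- The printed fit of the La₂₋ₓSrₓCuO₄ normal-state Sommerfeld coefficient (mJ mol⁻¹ K⁻²; data compiled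
from Matsuzaki et al.): `γ_n = ζ(p − p_c)^η`, `ζ = 182.6`, `p_c = 0.03`, `η = 1.54`.
[cite: WenEtAl2005LSCONodalGapSlopeSpecificHeat, p. 5 and Fig. 5(a)] -/
def wenGammaN (p : ℝ) : ℝ := 182.6 * (p - 0.03) ^ (1.54 : ℝ)

/-- Unfolding. [cite: WenEtAl2005LSCONodalGapSlopeSpecificHeat, p. 5] -/
theorem wenGammaN_def (p : ℝ) : wenGammaN p = 182.6 * (p - 0.03) ^ (1.54 : ℝ) := rfl

/-- `1.54 = 77/50` (plumbing). [cite: WenEtAl2005LSCONodalGapSlopeSpecificHeat, p. 5] -/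
theorem wenGammaN_eq (p : ℝ) : wenGammaN p = 182.6 * (p - 0.03) ^ (((77 : ℕ) : ℝ) / (50 : ℕ)) := by
  rw [wenGammaN]; norm_num

/-- Plumbing: a window on `γ_n(p)` from `L⁵⁰ < (p − 0.03)⁷⁷ < U⁵⁰`.
[cite: WenEtAl2005LSCONodalGapSlopeSpecificHeat, p. 5] -/
theorem wenGammaN_window {p L U lo hi : ℝ} (hp : 0.03 ≤ p) (hL : 0 ≤ L) (hU : 0 ≤ U)
    (hlo' : (L ^ 50 : ℝ) < (p - 0.03) ^ 77) (hhi' : (p - 0.03) ^ 77 < (U ^ 50 : ℝ))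
    (hlo : lo ≤ 182.6 * L) (hhi : 182.6 * U ≤ hi) : lo < wenGammaN p ∧ wenGammaN p < hi := by
  have hx : 0 ≤ p - 0.03 := by linarith
  have hw := rpow_window (m := 77) (n := 50) hx hL hU (by norm_num) hlo' hhi'
  rw [wenGammaN_eq]
  constructor <;> nlinarith [hw.1, hw.2]

/-- THE γ_n ROWS (mJ mol⁻¹ K⁻², DERIVED from the printed fit): `p 0.07 ↦ (1.284, 1.285)` [M14] ·
`0.11 ↦ (3.734, 3.735)` · `0.125 ↦ (4.866, 4.867)` [M15] · `0.15 ↦ (6.973, 6.974)` [M16] ·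
`0.16 ↦ (7.887, 7.889)` · `0.178 ↦ (9.631, 9.632)` · `0.22 ↦ (14.150, 14.151)` [M17] ·
`0.30 ↦ (24.310, 24.312)` [M50; beyond the fit's plotted domain `p ≲ 0.22`].
[cite: WenEtAl2005LSCONodalGapSlopeSpecificHeat, p. 5 and Fig. 5(a)] -/
theorem lsco_gammaN_rows :
    (1.284 < wenGammaN 0.07 ∧ wenGammaN 0.07 < 1.285) ∧
    (3.734 < wenGammaN 0.11 ∧ wenGammaN 0.11 < 3.735) ∧
    (4.866 < wenGammaN 0.125 ∧ wenGammaN 0.125 < 4.867) ∧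
    (6.973 < wenGammaN 0.15 ∧ wenGammaN 0.15 < 6.974) ∧
    (7.887 < wenGammaN 0.16 ∧ wenGammaN 0.16 < 7.889) ∧
    (9.631 < wenGammaN 0.178 ∧ wenGammaN 0.178 < 9.632) ∧
    (14.150 < wenGammaN 0.22 ∧ wenGammaN 0.22 < 14.151) ∧
    (24.310 < wenGammaN 0.30 ∧ wenGammaN 0.30 < 24.312) := by
  refine ⟨?_, ?_, ?_, ?_, ?_, ?_, ?_, ?_⟩
  · exact wenGammaN_window (L := 0.007033) (U := 0.007034) (by norm_num) (by norm_num) (by norm_num)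
      (by norm_num) (by norm_num) (by norm_num) (by norm_num)
  · exact wenGammaN_window (L := 0.020453) (U := 0.020454) (by norm_num) (by norm_num) (by norm_num)
      (by norm_num) (by norm_num) (by norm_num) (by norm_num)
  · exact wenGammaN_window (L := 0.026649) (U := 0.02665) (by norm_num) (by norm_num) (by norm_num)
      (by norm_num) (by norm_num) (by norm_num) (by norm_num)
  · exact wenGammaN_window (L := 0.038189) (U := 0.03819) (by norm_num) (by norm_num) (by norm_num)
      (by norm_num) (by norm_num) (by norm_num) (by norm_num)
  · exact wenGammaN_window (L := 0.043198) (U := 0.043199) (by norm_num) (by norm_num) (by norm_num)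
      (by norm_num) (by norm_num) (by norm_num) (by norm_num)
  · exact wenGammaN_window (L := 0.052747) (U := 0.052748) (by norm_num) (by norm_num) (by norm_num)
      (by norm_num) (by norm_num) (by norm_num) (by norm_num)
  · exact wenGammaN_window (L := 0.077496) (U := 0.077497) (by norm_num) (by norm_num) (by norm_num)
      (by norm_num) (by norm_num) (by norm_num) (by norm_num)
  · exact wenGammaN_window (L := 0.133137) (U := 0.133138) (by norm_num) (by norm_num) (by norm_num)
      (by norm_num) (by norm_num) (by norm_num) (by norm_num)

/-- [WenEtAl2005LSCONodalGapSlopeSpecificHeat, Eq. 2] in closed form: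
`T_c = α_s ħ² v_F l_c γ_n v_Δ/(8 n k_B³ V_mol)`. [cite: WenEtAl2005LSCONodalGapSlopeSpecificHeat, Eq. 2] -/
def wenTc (αs vF lc γn vΔ n Vmol : ℝ) : ℝ := αs * hbarSI ^ 2 * vF * lc * γn * vΔ / (8 * n * boltzmannSI ^ 3 * Vmol)

/-- The coefficient `β` of the printed short form `T_c = βγ_n v_Δ`: `β = α_s ħ² v_F l_c/(8 n k_B³ V_mol)`.
[cite: WenEtAl2005LSCONodalGapSlopeSpecificHeat, Eq. 2] -/
def wenBeta (αs vF lc n Vmol : ℝ) : ℝ := αs * hbarSI ^ 2 * vF * lc / (8 * n * boltzmannSI ^ 3 * Vmol)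

/-- `T_c = β γ_n v_Δ`. [cite: WenEtAl2005LSCONodalGapSlopeSpecificHeat, Eq. 2] -/
theorem wenTc_eq_beta (αs vF lc γn vΔ n Vmol : ℝ) :
    wenTc αs vF lc γn vΔ n Vmol = wenBeta αs vF lc n Vmol * γn * vΔ := by
  unfold wenTc wenBeta; ring

/-- The printed normal-state coefficient of the Fermi-arc metal, `γ_n = 4nk_B²k_arc V_mol/(ħv_F l_c)`.
[cite: WenEtAl2005LSCONodalGapSlopeSpecificHeat, p. 5] -/
def arcGammaN (n karc Vmol vF lc : ℝ) : ℝ := 4 * n * boltzmannSI ^ 2 * karc * Vmol / (hbarSI * vF * lc)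

/-- With `γ_n` from the arcs, Eq. 2 reads `k_BT_c = (α_s/2) · ħ v_Δ k_arc` — the printed «effective
superconducting energy scale `E_s ∼ ½ v_Δ ħ k_arc`». [cite: WenEtAl2005LSCONodalGapSlopeSpecificHeat, p. 5] -/
theorem wenTc_arc (αs vF lc vΔ n Vmol karc : ℝ) (hn : n ≠ 0) (hV : Vmol ≠ 0) (hvF : vF ≠ 0) (hl : lc ≠ 0) :
    boltzmannSI * wenTc αs vF lc (arcGammaN n karc Vmol vF lc) vΔ n Vmol = αs / 2 * (hbarSI * vΔ * karc) := by
  have hk : boltzmannSI ≠ 0 := by norm_num [boltzmannSI_def]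
  have hh : hbarSI ≠ 0 := by
    unfold hbarSI; exact div_ne_zero planckSI_pos.ne' (by positivity)
  unfold wenTc arcGammaN
  field_simp
  ring

/-- Plumbing: a window on `c·x·y` from windows on `x` and `y` (`c > 0`, lower ends nonnegative). [folklore] -/
private theorem mul3_window {c x y xl xh yl yh lo hi : ℝ} (hc : 0 < c) (hxl : 0 ≤ xl) (hyl : 0 ≤ yl)
    (hx : xl < x ∧ x < xh) (hy : yl < y ∧ y < yh) (hlo : lo ≤ c * xl * yl) (hhi : c * xh * yh ≤ hi) :
    lo < c * x * y ∧ c * x * y < hi := by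
  have h1 : xl * yl < x * y := mul_lt_mul'' hx.1 hy.1 hxl hyl
  have h2 : x * y < xh * yh := mul_lt_mul'' hx.2 hy.2 (hxl.trans hx.1.le) (hyl.trans hy.1.le)
  have h1' := mul_lt_mul_of_pos_left h1 hc
  have h2' := mul_lt_mul_of_pos_left h2 hc
  constructor <;> nlinarith

/-- THE DERIVED `T_c` ROWS of Eq. 2 at the printed `β = 0.7445 K³ mol s J⁻¹ m⁻¹` (`× 10⁻³` for `γ_n` in mJ),
`γ_n` from the printed fit and `v_Δ(x)` from §2: `x 0.11 ↦ (33.1, 33.2)` · `0.15 ↦ (34.7, 34.8)` ·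
`0.178 ↦ (29.1, 29.2)` · `0.22 ↦ (22.3, 22.4) K` (the open squares of [WenEtAl2005…, Fig. 6]; measured `T_c`
29.3 / 36.1 / 36.0 / 27.4 K in [WangWen2008LSCOHc2, Table 1]). [cite: WenEtAl2005LSCONodalGapSlopeSpecificHeat, Eq. 2 and p. 5] -/
theorem lsco_wenTc_rows :
    (33.1 < 0.7445e-3 * wenGammaN 0.11 * vDeltaOfA 0.32 ∧ 0.7445e-3 * wenGammaN 0.11 * vDeltaOfA 0.32 < 33.2) ∧
    (34.7 < 0.7445e-3 * wenGammaN 0.15 * vDeltaOfA 0.57 ∧ 0.7445e-3 * wenGammaN 0.15 * vDeltaOfA 0.57 < 34.8) ∧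
    (29.1 < 0.7445e-3 * wenGammaN 0.178 * vDeltaOfA 0.94 ∧ 0.7445e-3 * wenGammaN 0.178 * vDeltaOfA 0.94 < 29.2) ∧
    (22.3 < 0.7445e-3 * wenGammaN 0.22 * vDeltaOfA 1.8 ∧ 0.7445e-3 * wenGammaN 0.22 * vDeltaOfA 1.8 < 22.4) := by
  obtain ⟨_, h11, _, h15, _, h178, h22, _⟩ := lsco_gammaN_rows
  obtain ⟨_, _, hv32, hv57, hv94, _, _, _, hv18, _⟩ := lsco_vDelta_rows
  exact ⟨mul3_window (by norm_num) (by norm_num) (by norm_num) h11 hv32 (by norm_num) (by norm_num),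
    mul3_window (by norm_num) (by norm_num) (by norm_num) h15 hv57 (by norm_num) (by norm_num),
    mul3_window (by norm_num) (by norm_num) (by norm_num) h178 hv94 (by norm_num) (by norm_num),
    mul3_window (by norm_num) (by norm_num) (by norm_num) h22 hv18 (by norm_num) (by norm_num)⟩

/-! ## §5 `H_c2 = 8a²γ_N²/(πA²)`: the same dictionary in [WangWen2008…] and [WangRevazErbJunod2001…, Eq. 13] -/

/-- [WangWen2008LSCOHc2, p. 2]: the field at which the Volovik `A√H` reaches the normal-state line,
`H_c2 = 8a²γ_N²/(πA²)` (`a = 0.465` for the d-wave vortex state). [cite: WangWen2008LSCOHc2, p. 2] -/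
def hc2OfVolovik (a γN A : ℝ) : ℝ := 8 * a ^ 2 * γN ^ 2 / (π * A ^ 2)

/-- Unfolding. [cite: WangWen2008LSCOHc2, p. 2] -/
theorem hc2OfVolovik_def (a γN A : ℝ) : hc2OfVolovik a γN A = 8 * a ^ 2 * γN ^ 2 / (π * A ^ 2) := rfl

/-- The leading high-field term of [WangRevazErbJunod2001YBCO7NodalSpecificHeat, Eqs. 6, 13],
`C/(γ_nT) = (8/π)^½ a (B/B_c2)^½`, i.e. `A_c = √(8/π) · a · γ_n/√B_c2` (the printed `1.596 a γ_n/B_c2^½`).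
[cite: WangRevazErbJunod2001YBCO7NodalSpecificHeat, Eq. 13] -/
def volovikAOfHc2 (a γN B : ℝ) : ℝ := Real.sqrt (8 / π) * a * γN / Real.sqrt B

/-- `√(8/π) ∈ (1.5957, 1.5958)` — the printed `1.596`. [cite: WangRevazErbJunod2001YBCO7NodalSpecificHeat, Eq. 13] -/
theorem sqrt_eight_div_pi_bounds : 1.5957 < Real.sqrt (8 / π) ∧ Real.sqrt (8 / π) < 1.5958 := by
  have hπl := Real.pi_gt_d6; have hπu := Real.pi_lt_d6
  constructor
  · rw [Real.lt_sqrt (by norm_num), lt_div_iff₀ Real.pi_pos]; nlinarith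
  · rw [Real.sqrt_lt' (by norm_num), div_lt_iff₀ Real.pi_pos]; nlinarith

/-- THE TWO PRINTS ARE ONE DICTIONARY: inverting `A = √(8/π) a γ_N/√B` for `B > 0` gives
`B = 8a²γ_N²/(πA²)`. [cite: WangWen2008LSCOHc2, p. 2]; [cite: WangRevazErbJunod2001YBCO7NodalSpecificHeat, Eq. 13] -/
theorem hc2OfVolovik_volovikAOfHc2 {a γN B : ℝ} (ha : a ≠ 0) (hγ : γN ≠ 0) (hB : 0 < B) :
    hc2OfVolovik a γN (volovikAOfHc2 a γN B) = B := by
  have hπ : (0 : ℝ) < π := Real.pi_pos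
  have h8 : Real.sqrt (8 / π) ^ 2 = 8 / π := Real.sq_sqrt (by positivity)
  have hB' : Real.sqrt B ^ 2 = B := Real.sq_sqrt hB.le
  have hsB : Real.sqrt B ≠ 0 := (Real.sqrt_pos.mpr hB).ne'
  have hs8 : Real.sqrt (8 / π) ≠ 0 := (Real.sqrt_pos.mpr (by positivity)).ne'
  unfold hc2OfVolovik volovikAOfHc2
  rw [div_pow, mul_pow, mul_pow, h8, hB']
  field_simp

/-- `H_c2` scales as `(γ_N/A)²`: doubling `A` at fixed `γ_N` quarters it.
[cite: WangWen2008LSCOHc2, p. 2 («H_c2 ∝ (γ_N/A)²»)] -/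
theorem hc2OfVolovik_double_A (a γN A : ℝ) : hc2OfVolovik a γN (2 * A) = hc2OfVolovik a γN A / 4 := by
  unfold hc2OfVolovik; ring

/-- The γ_N IMPLIED by two printed columns: `γ_N = A · √(πH_c2/8)/a`. [cite: WangWen2008LSCOHc2, p. 2 and Table 1] -/
def gammaNOfHc2 (a A H : ℝ) : ℝ := A * Real.sqrt (π * H / 8) / a

/-- Unfolding. [cite: WangWen2008LSCOHc2, p. 2] -/
theorem gammaNOfHc2_def (a A H : ℝ) : gammaNOfHc2 a A H = A * Real.sqrt (π * H / 8) / a := rfl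

/-- ROUND TRIP: `H_c2(a, γ_N(a, A, H), A) = H` for `H ≥ 0`, `a, A ≠ 0`. [cite: WangWen2008LSCOHc2, p. 2] -/
theorem hc2OfVolovik_gammaNOfHc2 {a A H : ℝ} (ha : a ≠ 0) (hA : A ≠ 0) (hH : 0 ≤ H) :
    hc2OfVolovik a (gammaNOfHc2 a A H) A = H := by
  have hπ : (0 : ℝ) < π := Real.pi_pos
  have hs : Real.sqrt (π * H / 8) ^ 2 = π * H / 8 := Real.sq_sqrt (by positivity)
  unfold hc2OfVolovik gammaNOfHc2
  rw [div_pow, mul_pow, hs]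
  field_simp

/-- Plumbing: a window on `γ_N(0.465, A, H)` from a window on `πH/8`.
[cite: WangWen2008LSCOHc2, p. 2] -/
theorem gammaNOfHc2_window {A H lo hi slo shi : ℝ} (hA : 0 < A) (hH : 0 < H) (hslo : 0 ≤ slo)
    (hshi : 0 < shi) (hlo' : slo ^ 2 ≤ 3.141592 * H / 8) (hhi' : 3.141593 * H / 8 ≤ shi ^ 2)
    (hlo : lo * 0.465 ≤ A * slo) (hhi : A * shi ≤ hi * 0.465) :
    lo < gammaNOfHc2 0.465 A H ∧ gammaNOfHc2 0.465 A H < hi := by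
  have hπl := Real.pi_gt_d6; have hπu := Real.pi_lt_d6
  have hsl : slo < Real.sqrt (π * H / 8) := by
    rw [Real.lt_sqrt hslo]; nlinarith
  have hsu : Real.sqrt (π * H / 8) < shi := by
    rw [Real.sqrt_lt' hshi]; nlinarith
  unfold gammaNOfHc2
  constructor
  · rw [lt_div_iff₀ (by norm_num)]
    nlinarith [mul_lt_mul_of_pos_left hsl hA]
  · rw [div_lt_iff₀ (by norm_num)]
    nlinarith [mul_lt_mul_of_pos_left hsu hA]

/-- THE γ_N COLUMN IMPLIED BY [WangWen2008LSCOHc2, Table 1] (`A` mJ mol⁻¹ K⁻² T⁻½, `H_c2(0)` T, `a = 0.465`),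
mJ mol⁻¹ K⁻² (DERIVED; the table prints `A` and `H_c2`, not `γ_N`):
`x 0.063: (0.26, 16) ↦ (1.40, 1.41)` · `0.069: (0.28, 17) ↦ (1.55, 1.56)` · `0.075: (0.26, 39) ↦ (2.18, 2.19)` ·
`0.09: (0.28, 53) ↦ (2.74, 2.75)` · `0.11: (0.32, 75) ↦ (3.73, 3.74)` · `0.15: (0.57, 82) ↦ (6.95, 6.96)` ·
`0.178: (0.94, 56) ↦ (9.47, 9.49)` · `0.19: (1.2, 45) ↦ (10.84, 10.86)` · `0.202: (1.33, 45) ↦ (12.02, 12.03)` ·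
`0.218: (1.55, 44) ↦ (13.85, 13.86)` · `0.22: (1.8, 36) ↦ (14.55, 14.56)` · `0.238: (2.37, 17) ↦ (13.16, 13.18)`;
compare the printed fit of §4 (`3.73 / 6.97 / 9.63 / 10.86 / 12.14 / 13.92 / 14.15` at `x = 0.11 … 0.22`).
[cite: WangWen2008LSCOHc2, Table 1 and p. 2] -/
theorem lsco_impliedGammaN_rows :
    (1.40 < gammaNOfHc2 0.465 0.26 16 ∧ gammaNOfHc2 0.465 0.26 16 < 1.41) ∧
    (1.55 < gammaNOfHc2 0.465 0.28 17 ∧ gammaNOfHc2 0.465 0.28 17 < 1.56) ∧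
    (2.18 < gammaNOfHc2 0.465 0.26 39 ∧ gammaNOfHc2 0.465 0.26 39 < 2.19) ∧
    (2.74 < gammaNOfHc2 0.465 0.28 53 ∧ gammaNOfHc2 0.465 0.28 53 < 2.75) ∧
    (3.73 < gammaNOfHc2 0.465 0.32 75 ∧ gammaNOfHc2 0.465 0.32 75 < 3.74) ∧
    (6.95 < gammaNOfHc2 0.465 0.57 82 ∧ gammaNOfHc2 0.465 0.57 82 < 6.96) ∧
    (9.47 < gammaNOfHc2 0.465 0.94 56 ∧ gammaNOfHc2 0.465 0.94 56 < 9.49) ∧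
    (10.84 < gammaNOfHc2 0.465 1.2 45 ∧ gammaNOfHc2 0.465 1.2 45 < 10.86) ∧
    (12.02 < gammaNOfHc2 0.465 1.33 45 ∧ gammaNOfHc2 0.465 1.33 45 < 12.03) ∧
    (13.85 < gammaNOfHc2 0.465 1.55 44 ∧ gammaNOfHc2 0.465 1.55 44 < 13.86) ∧
    (14.55 < gammaNOfHc2 0.465 1.8 36 ∧ gammaNOfHc2 0.465 1.8 36 < 14.56) ∧
    (13.16 < gammaNOfHc2 0.465 2.37 17 ∧ gammaNOfHc2 0.465 2.37 17 < 13.18) := by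
  refine ⟨?_, ?_, ?_, ?_, ?_, ?_, ?_, ?_, ?_, ?_, ?_, ?_⟩
  · exact gammaNOfHc2_window (slo := 2.50662) (shi := 2.50663) (by norm_num) (by norm_num) (by norm_num)
      (by norm_num) (by norm_num) (by norm_num) (by norm_num) (by norm_num)
  · exact gammaNOfHc2_window (slo := 2.58377) (shi := 2.58378) (by norm_num) (by norm_num) (by norm_num)
      (by norm_num) (by norm_num) (by norm_num) (by norm_num) (by norm_num)
  · exact gammaNOfHc2_window (slo := 3.91347) (shi := 3.91348) (by norm_num) (by norm_num) (by norm_num)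
      (by norm_num) (by norm_num) (by norm_num) (by norm_num) (by norm_num)
  · exact gammaNOfHc2_window (slo := 4.56213) (shi := 4.56214) (by norm_num) (by norm_num) (by norm_num)
      (by norm_num) (by norm_num) (by norm_num) (by norm_num) (by norm_num)
  · exact gammaNOfHc2_window (slo := 5.42700) (shi := 5.42701) (by norm_num) (by norm_num) (by norm_num)
      (by norm_num) (by norm_num) (by norm_num) (by norm_num) (by norm_num)
  · exact gammaNOfHc2_window (slo := 5.67462) (shi := 5.67463) (by norm_num) (by norm_num) (by norm_num)
      (by norm_num) (by norm_num) (by norm_num) (by norm_num) (by norm_num)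
  · exact gammaNOfHc2_window (slo := 4.68947) (shi := 4.68948) (by norm_num) (by norm_num) (by norm_num)
      (by norm_num) (by norm_num) (by norm_num) (by norm_num) (by norm_num)
  · exact gammaNOfHc2_window (slo := 4.20374) (shi := 4.20375) (by norm_num) (by norm_num) (by norm_num)
      (by norm_num) (by norm_num) (by norm_num) (by norm_num) (by norm_num)
  · exact gammaNOfHc2_window (slo := 4.20374) (shi := 4.20375) (by norm_num) (by norm_num) (by norm_num)
      (by norm_num) (by norm_num) (by norm_num) (by norm_num) (by norm_num)
  · exact gammaNOfHc2_window (slo := 4.15677) (shi := 4.15678) (by norm_num) (by norm_num) (by norm_num)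
      (by norm_num) (by norm_num) (by norm_num) (by norm_num) (by norm_num)
  · exact gammaNOfHc2_window (slo := 3.75994) (shi := 3.75995) (by norm_num) (by norm_num) (by norm_num)
      (by norm_num) (by norm_num) (by norm_num) (by norm_num) (by norm_num)
  · exact gammaNOfHc2_window (slo := 2.58377) (shi := 2.58378) (by norm_num) (by norm_num) (by norm_num)
      (by norm_num) (by norm_num) (by norm_num) (by norm_num) (by norm_num)

/-! ## §6 [WangRevazErbJunod2001…, Eqs. 15–16]: `A_c`, the Kübert–Hirschfeld `α`, their ratio, and the YBa₂Cu₃O₇ chain -/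

/-- [WangRevazErbJunod2001YBCO7NodalSpecificHeat, Eq. 15]: `A_c = (8k_B²/3ħΦ₀^½)(V_mol/d)(a/v₂)` (SI;
`d = c/2` the mean interlayer distance, `a` the vortex-lattice constant of order one).
[cite: WangRevazErbJunod2001YBCO7NodalSpecificHeat, Eq. 15] -/
def wrejAc (a Vmol d v2 : ℝ) : ℝ := 8 * boltzmannSI ^ 2 / (3 * hbarSI * Real.sqrt scFluxQuantum) * (Vmol / d) * (a / v2)

/-- Unfolding. [cite: WangRevazErbJunod2001YBCO7NodalSpecificHeat, Eq. 15] -/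
theorem wrejAc_def (a Vmol d v2 : ℝ) :
    wrejAc a Vmol d v2 = 8 * boltzmannSI ^ 2 / (3 * hbarSI * Real.sqrt scFluxQuantum) * (Vmol / d) * (a / v2) := rfl

/-- With `ħ = h/2π`: `A_c = 16πk_B²V_mol a/(3hΦ₀^½ d v₂)`. [cite: WangRevazErbJunod2001YBCO7NodalSpecificHeat, Eq. 15] -/
theorem wrejAc_eq (a Vmol d v2 : ℝ) : wrejAc a Vmol d v2 =
    16 * boltzmannSI ^ 2 * Vmol * a / (3 * planckSI * Real.sqrt scFluxQuantum * d * v2) * π := by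
  unfold wrejAc hbarSI
  have hπ : (π : ℝ) ≠ 0 := Real.pi_ne_zero
  have hh : planckSI ≠ 0 := planckSI_pos.ne'
  have hw : Real.sqrt scFluxQuantum ≠ 0 := sqrt_scFluxQuantum_pos.ne'
  by_cases hd : d = 0
  · subst hd; simp
  by_cases hv : v2 = 0
  · subst hv; simp
  field_simp
  ring

/-- The two prints of the Volovik coefficient are one formula: [WenEtAl2005…, Eq. 1] with `nV_mol/l_c ↦ V_mol/d`
equals [WangRevazErbJunod2001…, Eq. 15] with `a = (√π/2)·α_p` (for Wen's `α_p = 0.465`, `a ≈ 0.412`;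
Wang et al. FIT `a ≅ 0.70`). [cite: WenEtAl2005LSCONodalGapSlopeSpecificHeat, Eq. 1];
[cite: WangRevazErbJunod2001YBCO7NodalSpecificHeat, Eq. 15 and note 33] -/
theorem volovikA_eq_wrejAc (αp lc Vmol n vΔ : ℝ) :
    volovikA αp lc Vmol n vΔ = wrejAc (Real.sqrt π / 2 * αp) (n * Vmol) lc vΔ := by
  have hπ : 0 ≤ π := Real.pi_pos.le
  have hsq : Real.sqrt (π / scFluxQuantum) = Real.sqrt π / Real.sqrt scFluxQuantum :=
    Real.sqrt_div' _ scFluxQuantum_pos.le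
  have hπs : Real.sqrt π * Real.sqrt π = π := Real.mul_self_sqrt hπ
  have hw : Real.sqrt scFluxQuantum ≠ 0 := sqrt_scFluxQuantum_pos.ne'
  have hh : hbarSI ≠ 0 := by unfold hbarSI; exact div_ne_zero planckSI_pos.ne' (by positivity)
  unfold volovikA wrejAc
  rw [hsq]
  by_cases hl : lc = 0
  · subst hl; simp
  by_cases hv : vΔ = 0
  · subst hv; simp
  field_simp
  nlinarith [hπs]

/-- `(√π/2)·0.465 ∈ (0.4120, 0.4122)` — Wen's triangular-lattice `α_p` in Wang et al.'s `a`-convention.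
[cite: WangRevazErbJunod2001YBCO7NodalSpecificHeat, note 33] -/
theorem wen_alpha_as_wrej_a : 0.4120 < Real.sqrt π / 2 * 0.465 ∧ Real.sqrt π / 2 * 0.465 < 0.4122 := by
  have hl : 1.77245 < Real.sqrt π := by rw [Real.lt_sqrt (by norm_num)]; nlinarith [Real.pi_gt_d6]
  have hu : Real.sqrt π < 1.77246 := by rw [Real.sqrt_lt' (by norm_num)]; nlinarith [Real.pi_lt_d6]
  constructor <;> nlinarith

/-- [WangRevazErbJunod2001YBCO7NodalSpecificHeat, Eq. 16] (Kübert–Hirschfeld):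
`α = (18ζ(3)k_B³/πħ²)(V_mol/d)/(v₂v_F)`; `ζ(3)` is a parameter (`1.202…` in print).
[cite: WangRevazErbJunod2001YBCO7NodalSpecificHeat, Eq. 16] -/
def kubertHirschfeldAlpha (ζ3 Vmol d v2 vF : ℝ) : ℝ :=
  18 * ζ3 * boltzmannSI ^ 3 / (π * hbarSI ^ 2) * (Vmol / d) / (v2 * vF)

/-- Unfolding. [cite: WangRevazErbJunod2001YBCO7NodalSpecificHeat, Eq. 16] -/
theorem kubertHirschfeldAlpha_def (ζ3 Vmol d v2 vF : ℝ) : kubertHirschfeldAlpha ζ3 Vmol d v2 vF =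
    18 * ζ3 * boltzmannSI ^ 3 / (π * hbarSI ^ 2) * (Vmol / d) / (v2 * vF) := rfl

/-- With `ħ = h/2π`: `α = 72πζ(3)k_B³V_mol/(h²d v₂v_F)`. [cite: WangRevazErbJunod2001YBCO7NodalSpecificHeat, Eq. 16] -/
theorem kubertHirschfeldAlpha_eq (ζ3 Vmol d v2 vF : ℝ) : kubertHirschfeldAlpha ζ3 Vmol d v2 vF =
    72 * ζ3 * boltzmannSI ^ 3 * Vmol / (planckSI ^ 2 * d * (v2 * vF)) * π := by
  unfold kubertHirschfeldAlpha hbarSI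
  have hπ : (π : ℝ) ≠ 0 := Real.pi_ne_zero
  have hh : planckSI ≠ 0 := planckSI_pos.ne'
  by_cases hd : d = 0
  · subst hd; simp
  by_cases hv : v2 * vF = 0
  · rw [hv]; simp
  field_simp
  ring

/-- `α · (v₂v_F)` is a material constant `K_α = 72πζ(3)k_B³V_mol/(h²d)`: the product `v₂v_F` follows from `α` alone.
[cite: WangRevazErbJunod2001YBCO7NodalSpecificHeat, Eq. 16 («which yields v₂v_F ≅ 1.4 × 10¹³ (cm/s)²»)] -/
def kAlpha (ζ3 Vmol d : ℝ) : ℝ := 72 * ζ3 * boltzmannSI ^ 3 * Vmol / (planckSI ^ 2 * d) * π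

/-- Unfolding. [cite: WangRevazErbJunod2001YBCO7NodalSpecificHeat, Eq. 16] -/
theorem kAlpha_def (ζ3 Vmol d : ℝ) : kAlpha ζ3 Vmol d = 72 * ζ3 * boltzmannSI ^ 3 * Vmol / (planckSI ^ 2 * d) * π := rfl

/-- `α = K_α/(v₂v_F)`. [cite: WangRevazErbJunod2001YBCO7NodalSpecificHeat, Eq. 16] -/
theorem kubertHirschfeldAlpha_eq_kAlpha (ζ3 Vmol d v2 vF : ℝ) :
    kubertHirschfeldAlpha ζ3 Vmol d v2 vF = kAlpha ζ3 Vmol d / (v2 * vF) := by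
  rw [kubertHirschfeldAlpha_eq, kAlpha]
  by_cases hd : d = 0
  · subst hd; simp
  by_cases hv : v2 * vF = 0
  · rw [hv]; simp
  have hh : planckSI ≠ 0 := planckSI_pos.ne'
  field_simp

/-- THE RATIO: `A_c/α = (4πħ/27ζ(3)Φ₀^½k_B)·a v_F = (2h/27ζ(3)Φ₀^½k_B)·a v_F` — `V_mol/d` and `v₂` drop out,
and so does `π`; «the ratio … depends only on the Fermi velocity» (times the geometric `a`).
[cite: WangRevazErbJunod2001YBCO7NodalSpecificHeat, Eq. 11] -/
theorem wrej_ratio_eq {ζ3 Vmol d v2 vF a : ℝ} (hζ : ζ3 ≠ 0) (hV : Vmol ≠ 0) (hd : d ≠ 0) (hv2 : v2 ≠ 0)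
    (hvF : vF ≠ 0) :
    wrejAc a Vmol d v2 / kubertHirschfeldAlpha ζ3 Vmol d v2 vF =
      4 * π * hbarSI / (27 * ζ3 * Real.sqrt scFluxQuantum * boltzmannSI) * (a * vF) ∧
    4 * π * hbarSI / (27 * ζ3 * Real.sqrt scFluxQuantum * boltzmannSI) =
      2 * planckSI / (27 * ζ3 * Real.sqrt scFluxQuantum * boltzmannSI) := by
  have hπ : (π : ℝ) ≠ 0 := Real.pi_ne_zero
  have hh : planckSI ≠ 0 := planckSI_pos.ne'
  have hw : Real.sqrt scFluxQuantum ≠ 0 := sqrt_scFluxQuantum_pos.ne'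
  have hk : boltzmannSI ≠ 0 := by norm_num [boltzmannSI_def]
  constructor
  · rw [wrejAc_eq, kubertHirschfeldAlpha_eq]
    unfold hbarSI
    field_simp
    ring
  · unfold hbarSI
    field_simp
    ring

/-- The d-wave node: `|dΔ/dφ|_{π/4} = ħk_Fv₂ = 2Δ₀`, by name the tree's `NodalHeatTransport.dWaveGap` and
`gapVelocity` (their `v₂ = slope/(ħk_F)`). [cite: WangRevazErbJunod2001YBCO7NodalSpecificHeat, p. 7 (after Eq. 15)] -/
theorem node_slope_dictionary {hbar kF Δ₀ : ℝ} (hh : hbar ≠ 0) (hk : kF ≠ 0) (hΔ : 0 ≤ Δ₀) :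
    |deriv (NodalHeatTransport.dWaveGap Δ₀) (π / 4)| = 2 * Δ₀ ∧
    hbar * kF * NodalHeatTransport.gapVelocity hbar kF (2 * Δ₀) = 2 * Δ₀ := by
  refine ⟨NodalHeatTransport.abs_deriv_dWaveGap_node hΔ, ?_⟩
  rw [NodalHeatTransport.gapVelocity_def]
  field_simp

/-- `T_F = ħk_Fv_F/2k_B = (Δ₀/k_B)(v_F/v₂)` once `ħk_Fv₂ = 2Δ₀`.
[cite: WangRevazErbJunod2001YBCO7NodalSpecificHeat, p. 8] -/
theorem fermiTemperature_eq {hbar kF vF v2 Δ₀ kB : ℝ} (hv2 : v2 ≠ 0) (hkB : kB ≠ 0)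
    (hnode : hbar * kF * v2 = 2 * Δ₀) : hbar * kF * vF / (2 * kB) = Δ₀ / kB * (vF / v2) := by
  have : hbar * kF = 2 * Δ₀ / v2 := by rw [← hnode]; field_simp
  rw [this]
  field_simp

/-- `m*/mₑ = ħk_F/(mₑv_F) = 2Δ₀/(mₑ v₂v_F)` once `ħk_Fv₂ = 2Δ₀`, and with `v₂v_F = K_α/α` this is
`2Δ₀α/(mₑK_α)`: «the latter ratio depends only on the product of experimental quantities Δ₀α».
[cite: WangRevazErbJunod2001YBCO7NodalSpecificHeat, p. 8] -/
theorem massEnhancement_eq {hbar kF vF v2 Δ₀ me K α : ℝ} (hv2 : v2 ≠ 0) (hvF : vF ≠ 0) (hα : α ≠ 0)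
    (hme : me ≠ 0) (hK : K ≠ 0) (hnode : hbar * kF * v2 = 2 * Δ₀) (hKα : α = K / (v2 * vF)) :
    hbar * kF / (me * vF) = 2 * Δ₀ / (me * (v2 * vF)) ∧ 2 * Δ₀ / (me * (v2 * vF)) = 2 * Δ₀ * α / (me * K) := by
  have h1 : hbar * kF = 2 * Δ₀ / v2 := by rw [← hnode]; field_simp
  have h2 : v2 * vF = K / α := by rw [hKα]; field_simp
  constructor
  · rw [h1]; field_simp
  · rw [h2]; field_simp

/-- THE PRINTED INPUTS of the YBa₂Cu₃O₇ chain (SI): `A_c = 1.34 mJ K⁻² T⁻½ mol⁻¹`, `α = 0.21 mJ K⁻³ mol⁻¹`,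
`V_mol = 104.6 cm³`, `d = c/2 = 0.584 nm`, `ζ(3) ↦ 1.202`, `Δ₀ = 20 meV` (STS), `v_F/v₂ = 14` (Chiao et al.):
the material constant `K_α`. [cite: WangRevazErbJunod2001YBCO7NodalSpecificHeat, pp. 7–8 and Table I] -/
def ybcoKAlpha : ℝ := kAlpha 1.202 104.6e-6 0.584e-9

/-- Unfolding. [cite: WangRevazErbJunod2001YBCO7NodalSpecificHeat, Eq. 16] -/
theorem ybcoKAlpha_def : ybcoKAlpha = kAlpha 1.202 104.6e-6 0.584e-9 := rfl

/-- `K_α(YBa₂Cu₃O₇) ∈ (291906, 291907) J mol⁻¹ K⁻³ · m² s⁻²`. [cite: WangRevazErbJunod2001YBCO7NodalSpecificHeat, Eq. 16] -/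
theorem ybcoKAlpha_bounds : 291906 < ybcoKAlpha ∧ ybcoKAlpha < 291907 := by
  have hπl := Real.pi_gt_d20; have hπu := Real.pi_lt_d20
  rw [ybcoKAlpha, kAlpha, boltzmannSI_def, planckSI_def]
  constructor
  · norm_num; nlinarith
  · norm_num; nlinarith

/-- ROW (Eq. 16): `v₂v_F = K_α/α ∈ (1.3900, 1.3901) × 10⁹ m² s⁻²` — the printed «≅ 1.4 × 10¹³ (cm/s)²».
[cite: WangRevazErbJunod2001YBCO7NodalSpecificHeat, p. 8] -/
theorem ybco_v2vF_row : 1.3900e9 < ybcoKAlpha / 0.21e-3 ∧ ybcoKAlpha / 0.21e-3 < 1.3901e9 := by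
  have h := ybcoKAlpha_bounds
  constructor
  · rw [lt_div_iff₀ (by norm_num)]; linarith
  · rw [div_lt_iff₀ (by norm_num)]; linarith

/-- The material constant of Eq. 15, `K_A = 16πk_B²V_mol/(3hΦ₀^½d)` (`J mol⁻¹ K⁻² T⁻½ · m s⁻¹`): `A_c = K_A · a/v₂`.
[cite: WangRevazErbJunod2001YBCO7NodalSpecificHeat, Eq. 15] -/
def ybcoKA : ℝ := 16 * boltzmannSI ^ 2 * 104.6e-6 / (3 * planckSI * Real.sqrt scFluxQuantum * 0.584e-9) * π

/-- Unfolding. [cite: WangRevazErbJunod2001YBCO7NodalSpecificHeat, Eq. 15] -/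
theorem ybcoKA_def :
    ybcoKA = 16 * boltzmannSI ^ 2 * 104.6e-6 / (3 * planckSI * Real.sqrt scFluxQuantum * 0.584e-9) * π := rfl

/-- `A_c(a, v₂) = K_A · a/v₂` for YBa₂Cu₃O₇. [cite: WangRevazErbJunod2001YBCO7NodalSpecificHeat, Eq. 15] -/
theorem wrejAc_ybco (a v2 : ℝ) : wrejAc a 104.6e-6 0.584e-9 v2 = ybcoKA * (a / v2) := by
  rw [wrejAc_eq, ybcoKA]
  by_cases hv : v2 = 0
  · subst hv; simp
  have hh : planckSI ≠ 0 := planckSI_pos.ne'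
  have hw : Real.sqrt scFluxQuantum ≠ 0 := sqrt_scFluxQuantum_pos.ne'
  field_simp

/-- `K_A ∈ (18.9854, 18.9855)`. [cite: WangRevazErbJunod2001YBCO7NodalSpecificHeat, Eq. 15] -/
theorem ybcoKA_bounds : 18.9854 < ybcoKA ∧ ybcoKA < 18.9855 := by
  have hw := sqrt_scFluxQuantum_bounds
  have hwp := sqrt_scFluxQuantum_pos
  have hπl := Real.pi_gt_d6; have hπu := Real.pi_lt_d6
  rw [ybcoKA, boltzmannSI_def, planckSI_def]
  have hden : 0 < 3 * (662607015 / 10 ^ 42 : ℝ) * Real.sqrt scFluxQuantum * 0.584e-9 := by positivity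
  constructor
  · rw [div_mul_eq_mul_div, lt_div_iff₀ hden]; norm_num; nlinarith
  · rw [div_mul_eq_mul_div, div_lt_iff₀ hden]; norm_num; nlinarith

/-- ROW (Eq. 15): `v₂/a = K_A/A_c ∈ (14168, 14169) m s⁻¹` — the printed «v₂/a ≅ 1.4 × 10⁶ cm/s».
[cite: WangRevazErbJunod2001YBCO7NodalSpecificHeat, p. 7] -/
theorem ybco_v2_over_a_row : 14168 < ybcoKA / 1.34e-3 ∧ ybcoKA / 1.34e-3 < 14169 := by
  have h := ybcoKA_bounds
  constructor
  · rw [lt_div_iff₀ (by norm_num)]; linarith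
  · rw [div_lt_iff₀ (by norm_num)]; linarith

/-- ROW (Eq. 11): `A_c/α = 1.34/0.21 ∈ (6.380, 6.381) K T⁻½` (printed `T_cross/B^½ = 6.4`), and
`a v_F = (A_c/α)·27ζ(3)Φ₀^½k_B/(2h) ∈ (98108, 98110) m s⁻¹` — the printed «a v_F ≅ 1.0 × 10⁷ cm/s».
[cite: WangRevazErbJunod2001YBCO7NodalSpecificHeat, pp. 7–8] -/
theorem ybco_ratio_rows : (6.380 < (1.34 : ℝ) / 0.21 ∧ (1.34 : ℝ) / 0.21 < 6.381) ∧
    98108 < 1.34 / 0.21 * (27 * 1.202 * Real.sqrt scFluxQuantum * boltzmannSI) / (2 * planckSI) ∧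
    1.34 / 0.21 * (27 * 1.202 * Real.sqrt scFluxQuantum * boltzmannSI) / (2 * planckSI) < 98110 := by
  have hw := sqrt_scFluxQuantum_bounds
  refine ⟨⟨by norm_num, by norm_num⟩, ?_, ?_⟩
  · rw [boltzmannSI_def, planckSI_def, lt_div_iff₀ (by norm_num)]; norm_num; nlinarith
  · rw [boltzmannSI_def, planckSI_def, div_lt_iff₀ (by norm_num)]; norm_num; nlinarith

/-- `a v_F` of the row inverts the ratio formula: `(2h/27ζ(3)Φ₀^½k_B)·(a v_F) = A_c/α`.
[cite: WangRevazErbJunod2001YBCO7NodalSpecificHeat, Eq. 11] -/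
theorem ybco_avF_inverts :
    2 * planckSI / (27 * 1.202 * Real.sqrt scFluxQuantum * boltzmannSI) *
      (1.34 / 0.21 * (27 * 1.202 * Real.sqrt scFluxQuantum * boltzmannSI) / (2 * planckSI)) = 1.34 / 0.21 := by
  have hh : planckSI ≠ 0 := planckSI_pos.ne'
  have hw : Real.sqrt scFluxQuantum ≠ 0 := sqrt_scFluxQuantum_pos.ne'
  have hk : boltzmannSI ≠ 0 := by norm_num [boltzmannSI_def]
  field_simp

/-- ROW: with `Δ₀ = 20 meV` the bulk term `α = (27ζ(3)/π²)γ_nk_B/Δ₀` (Eq. 7) inverts to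
`γ_n = αΔ₀π²/(27ζ(3)k_B) ∈ (14.82, 14.83) mJ K⁻² mol⁻¹` — the printed «γ_n ≅ 15»; `27ζ(3)/π² ∈ (3.288, 3.289)`
is the printed `3.288`. [cite: WangRevazErbJunod2001YBCO7NodalSpecificHeat, Eqs. 7, 13 and p. 7] -/
theorem ybco_gammaN_row : (3.288 < 27 * 1.202 / π ^ 2 ∧ 27 * 1.202 / π ^ 2 < 3.289) ∧
    14.82e-3 < 0.21e-3 * (20e-3 * elementaryChargeSI) * π ^ 2 / (27 * 1.202 * boltzmannSI) ∧
    0.21e-3 * (20e-3 * elementaryChargeSI) * π ^ 2 / (27 * 1.202 * boltzmannSI) < 14.83e-3 := by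
  have hπl := Real.pi_gt_d6; have hπu := Real.pi_lt_d6
  have hp2l : (3.141592 : ℝ) ^ 2 < π ^ 2 := pow_lt_pow_left₀ hπl (by norm_num) (by norm_num)
  have hp2u : π ^ 2 < (3.141593 : ℝ) ^ 2 := pow_lt_pow_left₀ hπu Real.pi_pos.le (by norm_num)
  have hp2 : 0 < π ^ 2 := by positivity
  refine ⟨⟨?_, ?_⟩, ?_, ?_⟩
  · rw [lt_div_iff₀ hp2]; nlinarith
  · rw [div_lt_iff₀ hp2]; nlinarith
  · rw [elementaryChargeSI_def, boltzmannSI_def, lt_div_iff₀ (by norm_num)]; norm_num at hp2l ⊢; nlinarith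
  · rw [elementaryChargeSI_def, boltzmannSI_def, div_lt_iff₀ (by norm_num)]; norm_num at hp2u ⊢; nlinarith

/-- `(8/π)(γ_n/A_c)² = 8π³(αΔ₀/27ζ(3)k_BA_c)²` when `γ_n = αΔ₀π²/(27ζ(3)k_B)` (plumbing: the printed
`B_c2/a²` as one expression). [cite: WangRevazErbJunod2001YBCO7NodalSpecificHeat, Eqs. 7, 13] -/
theorem hc2_over_a2_eq (α Δ₀ ζ3 kB Ac : ℝ) (hζ : ζ3 ≠ 0) (hk : kB ≠ 0) (hA : Ac ≠ 0) :
    hc2OfVolovik 1 (α * Δ₀ * π ^ 2 / (27 * ζ3 * kB)) Ac = 8 * π ^ 3 * (α * Δ₀ / (27 * ζ3 * kB * Ac)) ^ 2 := by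
  have hπ : (π : ℝ) ≠ 0 := Real.pi_ne_zero
  unfold hc2OfVolovik
  field_simp

/-- ROW (Eq. 13 inverted, §5): `B_c2/a² = (8/π)(γ_n/A_c)² = 8π³(αΔ₀/27ζ(3)k_BA_c)² ∈ (311.5, 311.6) T` — the
printed «B_c2/a² ≅ 310 T» (with `a ≈ 0.70`, `B_c2 ≈ 154 T`, printed «≅ 150 T»).
[cite: WangRevazErbJunod2001YBCO7NodalSpecificHeat, pp. 7–8] -/
theorem ybco_Bc2_row :
    311.5 < 8 * π ^ 3 * (0.21e-3 * (20e-3 * elementaryChargeSI) / (27 * 1.202 * boltzmannSI * 1.34e-3)) ^ 2 ∧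
    8 * π ^ 3 * (0.21e-3 * (20e-3 * elementaryChargeSI) / (27 * 1.202 * boltzmannSI * 1.34e-3)) ^ 2 < 311.6 := by
  have h3l : (3.14159265358979323846 : ℝ) ^ 3 < π ^ 3 :=
    pow_lt_pow_left₀ Real.pi_gt_d20 (by norm_num) (by norm_num)
  have h3u : π ^ 3 < (3.14159265358979323847 : ℝ) ^ 3 :=
    pow_lt_pow_left₀ Real.pi_lt_d20 Real.pi_pos.le (by norm_num)
  rw [elementaryChargeSI_def, boltzmannSI_def]
  norm_num at h3l h3u ⊢
  constructor <;> nlinarith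

/-- ROWS: `T_F = (Δ₀/k_B)·14 ∈ (3249, 3250) K` at `Δ₀ = 20 meV` (printed «≅ 3300 K»); `k_F = 2Δ₀/(ħv₂) = 4πΔ₀/(hv₂)
∈ (0.6077, 0.6078) × 10¹⁰ m⁻¹` at `v₂ = 10⁴ m s⁻¹` (printed «≅ 0.6 Å⁻¹ ≅ ¾·π/a₁»; `¾π/3.85 ∈ (0.6119, 0.6121)`).
[cite: WangRevazErbJunod2001YBCO7NodalSpecificHeat, p. 8] -/
theorem ybco_TF_kF_rows :
    (3249 < 20e-3 * elementaryChargeSI / boltzmannSI * 14 ∧ 20e-3 * elementaryChargeSI / boltzmannSI * 14 < 3250) ∧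
    (0.6077e10 < 4 * π * (20e-3 * elementaryChargeSI) / (planckSI * 1e4) ∧
      4 * π * (20e-3 * elementaryChargeSI) / (planckSI * 1e4) < 0.6078e10) ∧
    (0.6119 < 3 / 4 * π / 3.85 ∧ 3 / 4 * π / 3.85 < 0.6121) := by
  have hπl := Real.pi_gt_d6; have hπu := Real.pi_lt_d6
  refine ⟨⟨?_, ?_⟩, ⟨?_, ?_⟩, ⟨?_, ?_⟩⟩
  · norm_num [elementaryChargeSI_def, boltzmannSI_def]
  · norm_num [elementaryChargeSI_def, boltzmannSI_def]
  · rw [elementaryChargeSI_def, planckSI_def, lt_div_iff₀ (by norm_num)]; norm_num; nlinarith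
  · rw [elementaryChargeSI_def, planckSI_def, div_lt_iff₀ (by norm_num)]; norm_num; nlinarith
  · rw [lt_div_iff₀ (by norm_num)]; nlinarith
  · rw [div_lt_iff₀ (by norm_num)]; nlinarith

/-- `2Δ₀/(ħv₂) = 4πΔ₀/(hv₂)` (plumbing for the `k_F` row). [cite: WangRevazErbJunod2001YBCO7NodalSpecificHeat, p. 8] -/
theorem kF_of_node_eq (Δ₀ v2 : ℝ) : 2 * Δ₀ / (hbarSI * v2) = 4 * π * Δ₀ / (planckSI * v2) := by
  unfold hbarSI
  have hπ : (π : ℝ) ≠ 0 := Real.pi_ne_zero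
  have hh : planckSI ≠ 0 := planckSI_pos.ne'
  by_cases hv : v2 = 0
  · subst hv; simp
  field_simp
  ring

/-- ROW: `m*/mₑ = 2Δ₀α/(mₑK_α) ∈ (5.06, 5.07)` at `Δ₀ = 20 meV`, `α = 0.21 × 10⁻³` — the printed «m*/mₑ ≅ 5»
(by name the tree's CODATA `PlanarSommerfeld.electronMassSI`). [cite: WangRevazErbJunod2001YBCO7NodalSpecificHeat, p. 8] -/
theorem ybco_mass_row :
    5.06 < 2 * (20e-3 * elementaryChargeSI) * 0.21e-3 / (PlanarSommerfeld.electronMassSI * ybcoKAlpha) ∧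
    2 * (20e-3 * elementaryChargeSI) * 0.21e-3 / (PlanarSommerfeld.electronMassSI * ybcoKAlpha) < 5.07 := by
  have hK := ybcoKAlpha_bounds
  have hm := PlanarSommerfeld.electronMassSI_pos
  have hden : 0 < PlanarSommerfeld.electronMassSI * ybcoKAlpha := by nlinarith [hK.1]
  constructor
  · rw [lt_div_iff₀ hden, elementaryChargeSI_def, PlanarSommerfeld.electronMassSI_def]; norm_num; nlinarith [hK.2]
  · rw [div_lt_iff₀ hden, elementaryChargeSI_def, PlanarSommerfeld.electronMassSI_def]; norm_num; nlinarith [hK.1]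

/-- ROWS with Chiao et al.'s `v_F/v₂ = 14`: `v_F = √(14·K_α/α) ∈ (139500, 139501) m s⁻¹` («≅ 1.4 × 10⁷ cm/s»),
`v₂ = v_F/14 ∈ (9964, 9965)` («≅ 1.0 × 10⁶ cm/s»), `a = (a v_F)/v_F ∈ (0.7032, 0.7034)` («a ≅ 0.70»).
[cite: WangRevazErbJunod2001YBCO7NodalSpecificHeat, p. 8] -/
theorem ybco_velocity_rows :
    (139500 < Real.sqrt (14 * (ybcoKAlpha / 0.21e-3)) ∧ Real.sqrt (14 * (ybcoKAlpha / 0.21e-3)) < 139501) ∧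
    (9964 < Real.sqrt (14 * (ybcoKAlpha / 0.21e-3)) / 14 ∧ Real.sqrt (14 * (ybcoKAlpha / 0.21e-3)) / 14 < 9965) ∧
    (0.7032 < 98108 / Real.sqrt (14 * (ybcoKAlpha / 0.21e-3)) ∧
      98110 / Real.sqrt (14 * (ybcoKAlpha / 0.21e-3)) < 0.7034) := by
  have hK := ybcoKAlpha_bounds
  have e : 14 * (ybcoKAlpha / 0.21e-3) = ybcoKAlpha * (14 / 0.21e-3) := by ring
  have hl : 139500 < Real.sqrt (14 * (ybcoKAlpha / 0.21e-3)) := by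
    rw [Real.lt_sqrt (by norm_num), e]; norm_num; nlinarith [hK.1]
  have hu : Real.sqrt (14 * (ybcoKAlpha / 0.21e-3)) < 139501 := by
    rw [Real.sqrt_lt' (by norm_num), e]; norm_num; nlinarith [hK.2]
  have hpos : 0 < Real.sqrt (14 * (ybcoKAlpha / 0.21e-3)) := by linarith
  refine ⟨⟨hl, hu⟩, ⟨by linarith, by linarith⟩, ⟨?_, ?_⟩⟩
  · rw [lt_div_iff₀ hpos]; nlinarith
  · rw [div_lt_iff₀ hpos]; nlinarith

/-! ## §7 The by-study YBa₂Cu₃O₇ hulls of REFVALS-2 §141.1 and the Debye image of Moler's `β` -/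

/-- The printed YBa₂Cu₃O₇ global-fit rows of [MolerEtAl1995YBCOSpecificHeatVortex, Table 1] (mJ, mol, K, T):
twinned T1 `(γ(0), n, β, α, A) = (3.0 ± 0.1, 24 ± 1, 0.392 ± 0.001, 0.11 ± 0.02, 0.91)`.
[cite: MolerEtAl1995YBCOSpecificHeatVortex, Table 1] -/
def molerT1 : ℝ × ℝ × ℝ × ℝ × ℝ := (3.0, 24, 0.392, 0.11, 0.91)

/-- The untwinned-crystal row U1 `(2.1 (+0.1/−0.2), 23 ± 1, 0.380 ± 0.004, 0.10 ± 0.06, 0.88)` of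
[MolerEtAl1995YBCOSpecificHeatVortex, Table 1]. [cite: MolerEtAl1995YBCOSpecificHeatVortex, Table 1] -/
def molerU1 : ℝ × ℝ × ℝ × ℝ × ℝ := (2.1, 23, 0.380, 0.10, 0.88)

/-- BY-STUDY HULLS for YBa₂Cu₃O₇ (REFVALS-2 §141.1): `α` across {ceramic `0.064 ± 0.02`, Moler `0.10–0.11`
(± 0.06 / ± 0.02), Wang et al. `0.21 ± 20 %`} spans `[0.04, 0.252]` mJ K⁻³ mol⁻¹ (centre ratios Wang/Moler-T1
`0.21/0.11 ∈ (1.90, 1.91)`, Wang/ceramic `0.21/0.064 ∈ (3.28, 3.29)`); `A` across {0.88, 0.91 (Moler, Wright),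
`1.34 ± 3 %`} spans `[0.88, 1.3802]`; `γ(0)` across the two Moler crystals spans `[1.9, 3.1]` — intervals, never
averaged. [cite: WangRevazErbJunod2001YBCO7NodalSpecificHeat, p. 3 and p. 7]; [cite: MolerEtAl1995YBCOSpecificHeatVortex, Table 1] -/
theorem ybco7_byStudy_hulls :
    (min (0.064 - 0.02) (min (0.10 - 0.06) (0.21 * (1 - 0.2))) = (0.04 : ℝ) ∧
      max (0.064 + 0.02) (max (0.11 + 0.02) (0.21 * (1 + 0.2))) = (0.252 : ℝ)) ∧
    (1.90 < (0.21 : ℝ) / 0.11 ∧ (0.21 : ℝ) / 0.11 < 1.91 ∧ 3.28 < (0.21 : ℝ) / 0.064 ∧ (0.21 : ℝ) / 0.064 < 3.29) ∧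
    (min molerU1.2.2.2.2 (min molerT1.2.2.2.2 (1.34 * (1 - 0.03))) = (0.88 : ℝ) ∧
      max molerU1.2.2.2.2 (max molerT1.2.2.2.2 (1.34 * (1 + 0.03))) = (1.3802 : ℝ)) ∧
    (min (molerU1.1 - 0.2) (molerT1.1 - 0.1) = (1.9 : ℝ) ∧ max (molerU1.1 + 0.1) (molerT1.1 + 0.1) = (3.1 : ℝ)) := by
  refine ⟨⟨?_, ?_⟩, ⟨by norm_num, by norm_num, by norm_num, by norm_num⟩, ⟨?_, ?_⟩, ⟨?_, ?_⟩⟩ <;>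
    norm_num [molerT1, molerU1, min_def, max_def]

/-- Plumbing: a `Debye.debyeTheta` window from a window on its cube (as in the tree's perovskite file).
[folklore] -/
private theorem debyeTheta_window {z β lo hi : ℝ} (hz : 0 ≤ z) (hβ : 0 < β) (hb : 0 ≤ hi)
    (hlo : lo ^ 3 < Debye.molarT3Const * z / β) (hhi : Debye.molarT3Const * z / β < hi ^ 3) :
    lo < Debye.debyeTheta z β ∧ Debye.debyeTheta z β < hi := by
  have h3 := Debye.debyeTheta_pow_three hz hβ
  have hk := Debye.debyeTheta_nonneg hz hβ
  constructor
  · by_contra hle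
    push Not at hle
    have := pow_le_pow_left₀ hk hle 3
    linarith
  · by_contra hle
    push Not at hle
    have := pow_le_pow_left₀ hb hle 3
    linarith

/-- THE DEBYE IMAGE of the printed lattice coefficients (13 atoms per YBa₂Cu₃O₇, `β` in J mol⁻¹ K⁻⁴):
`β = 0.392 × 10⁻³ ↦ Θ_D ∈ (400, 402) K` (T1), `0.380 × 10⁻³ ↦ (405, 406) K` (U1) — the printed
«β = 0.39 implying that Θ_D = 400 K». [cite: MolerEtAl1995YBCOSpecificHeatVortex, p. 4 and Table 1] -/
theorem moler_debye_rows :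
    (400 < Debye.debyeTheta 13 0.392e-3 ∧ Debye.debyeTheta 13 0.392e-3 < 402) ∧
    (405 < Debye.debyeTheta 13 0.380e-3 ∧ Debye.debyeTheta 13 0.380e-3 < 406) := by
  have hM := Debye.molarT3Const_bounds
  constructor
  · apply debyeTheta_window (by norm_num) (by norm_num) (by norm_num)
    · rw [lt_div_iff₀ (by norm_num)]; nlinarith [hM.1]
    · rw [div_lt_iff₀ (by norm_num)]; nlinarith [hM.2]
  · apply debyeTheta_window (by norm_num) (by norm_num) (by norm_num)
    · rw [lt_div_iff₀ (by norm_num)]; nlinarith [hM.1]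
    · rw [div_lt_iff₀ (by norm_num)]; nlinarith [hM.2]

/-- CROSS-READ of the nodal slope across probes (REFVALS-2 §141.3, numbers only): the YBa₂Cu₃O₇ specific-heat
`v₂/a ∈ (14168, 14169) m/s` and the Bi-2212 ARPES `v₂ = 1.25 × 10⁴ m/s` of [MesotEtAl1999Bi2212GapSlopeARPES]
(the tree's `NodalHeatTransport.mesot1999_gap`) are the same order: ratio `∈ (1.133, 1.134)`; the LSCO `v_Δ`
column FALLS ninefold across the dome (§2). [cite: WangRevazErbJunod2001YBCO7NodalSpecificHeat, p. 7];
[cite: MesotEtAl1999Bi2212GapSlopeARPES, p. 1] -/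
theorem crossProbe_orders : 1.133 < ybcoKA / 1.34e-3 / 1.25e4 ∧ ybcoKA / 1.34e-3 / 1.25e4 < 1.134 := by
  have h := ybco_v2_over_a_row
  constructor
  · rw [lt_div_iff₀ (by norm_num)]; linarith [h.1]
  · rw [div_lt_iff₀ (by norm_num)]; linarith [h.2]

end Literature.MathematicalPhysics.QuantumLattice.NodalSpecificHeat
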